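import Literature.Analysis.FunctionSpaces.LatticeChainFourier
import Literature.Analysis.FunctionSpaces.LatticeDispersion
import Mathlib.Algebra.BigOperators.Finprod
import HarnessLib

/-!
# The Fourier transform of a finitely supported lattice family, ambient-set free

Analysis/FunctionSpaces support file (module "P4b") for the lattice potential theory of `ℤ^d`
(proof programme of the named fact
`Literature.MathematicalPhysics.QuantumFieldTheory.FrohlichSpencerU1PerimeterLawD4`,
Fröhlich–Spencer 1982 (2.88)). `LatticeChainFourier.latFT S T` reads a family on an ambient finite
set `S`; here `latF T x = ∑ᶠ_y e_y(x) T(y)` is the same trigonometric polynomial without the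
bookkeeping of `S` (`latF_eq_latFT`), and the calculus is restated in this form:
linearity (`latF_sub`, `latF_add`, `latF_const_mul`, `latF_finset_sum`), translations
(`latF_comp_add : (T(·+a))^ = e_{-a} T̂`, `latF_comp_sub : (T(·-a))^ = e_{a} T̂`),
Plancherel (`integral_norm_sq_latF : ∫ ‖T̂‖² = ∑_y T(y)²`), continuity, the scalar second
difference operator `secondDiff` (`-Δ`) with `latF_secondDiff : (-ΔT)^ = μ · T̂`
(`μ = latticeDispersion`), via the unimodular identity
`two_sub_conj_sub_self : 2 - conj z - z = ‖z - 1‖²` (`‖z‖ = 1`).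
Everything is proved; no named fact is introduced.

## References

* J. Fröhlich, T. Spencer, Comm. Math. Phys. 83 (1982) 411–454, §2.5 (2.32)–(2.36), §2.10 (2.88).
  [FrohlichSpencerCMP1982]
-/

noncomputable section

open MeasureTheory Set Filter Complex Finset Function
open scoped Real ENNReal ComplexConjugate

namespace Literature.Analysis.FunctionSpaces

namespace LatticeFourier

variable {d : ℕ}

/-! ### Definition and the bridge to `latFT` -/

/-- **The Fourier transform of a lattice family** (a finite sum for finitely supported `T`, `0` by
convention otherwise): `T̂(x) = ∑ᶠ_y e_y(x) T(y)`. [folklore] -/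
def latF (T : (Fin d → ℤ) → ℝ) (x : UnitAddTorus (Fin d)) : ℂ :=
  ∑ᶠ y, UnitAddTorus.mFourier y x * (T y : ℂ)

/-- On any ambient finite set containing the support, `latF T = latFT S T`. [folklore] -/
theorem latF_eq_latFT {S : Finset (Fin d → ℤ)} {T : (Fin d → ℤ) → ℝ}
    (hS : Function.support T ⊆ S) : latF T = latFT S T := by
  funext x
  rw [latF, latFT_apply]
  refine finsum_eq_sum_of_support_subset _ fun y hy => ?_
  simp only [Function.mem_support, ne_eq, mul_eq_zero, Complex.ofReal_eq_zero, not_or] at hy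
  exact hS (Function.mem_support.2 hy.2)

/-- The support of a finitely supported family lies in its `toFinset`. [folklore] -/
theorem support_subset_toFinset {T : (Fin d → ℤ) → ℝ} (hT : HasFiniteSupport T) :
    Function.support T ⊆ (hT.toFinset : Finset (Fin d → ℤ)) := by
  simp

/-- `latF` of a finitely supported family is continuous. [folklore] -/
theorem continuous_latF {T : (Fin d → ℤ) → ℝ} (hT : HasFiniteSupport T) : Continuous (latF T) := by
  rw [latF_eq_latFT (support_subset_toFinset hT)]
  exact continuous_latFT _ _

/-- **Plancherel**: `∫ ‖T̂‖² = ∑_y T(y)²` for a finitely supported family. [folklore] -/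
theorem integral_norm_sq_latF {T : (Fin d → ℤ) → ℝ} (hT : HasFiniteSupport T) :
    ∫ x, ‖latF T x‖ ^ 2 = ∑' y, T y ^ 2 := by
  rw [latF_eq_latFT (support_subset_toFinset hT), integral_norm_sq_latFT]
  symm
  refine tsum_eq_sum_of_support_subset fun y hy => ?_
  have : T y ≠ 0 := by
    intro h; simp [h] at hy
  exact support_subset_toFinset hT (Function.mem_support.2 this)

/-! ### Linearity -/

/-- A common ambient finite set for two finitely supported families. [folklore] -/
theorem exists_common_finset {T U : (Fin d → ℤ) → ℝ} (hT : HasFiniteSupport T)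
    (hU : HasFiniteSupport U) :
    ∃ S : Finset (Fin d → ℤ), Function.support T ⊆ S ∧ Function.support U ⊆ S := by
  classical
  refine ⟨hT.toFinset ∪ hU.toFinset, ?_, ?_⟩
  · intro y hy
    simp only [Finset.coe_union, Set.mem_union, Set.Finite.coe_toFinset]
    exact Or.inl hy
  · intro y hy
    simp only [Finset.coe_union, Set.mem_union, Set.Finite.coe_toFinset]
    exact Or.inr hy

/-- `latF` of a difference. [folklore] -/
theorem latF_sub {T U : (Fin d → ℤ) → ℝ} (hT : HasFiniteSupport T) (hU : HasFiniteSupport U) :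
    latF (T - U) = latF T - latF U := by
  obtain ⟨S, hTS, hUS⟩ := exists_common_finset hT hU
  have hTUS : Function.support (T - U) ⊆ S :=
    (Function.support_sub T U).trans (Set.union_subset hTS hUS)
  rw [latF_eq_latFT hTUS, latF_eq_latFT hTS, latF_eq_latFT hUS, latFT_sub]

/-- `latF` of a sum. [folklore] -/
theorem latF_add {T U : (Fin d → ℤ) → ℝ} (hT : HasFiniteSupport T) (hU : HasFiniteSupport U) :
    latF (T + U) = latF T + latF U := by
  have h := latF_sub (hT.add hU) hU
  simp only [add_sub_cancel_right] at h
  rw [← sub_eq_iff_eq_add]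
  exact h.symm

/-- `latF` of a real multiple. [folklore] -/
theorem latF_const_mul (c : ℝ) {T : (Fin d → ℤ) → ℝ} (hT : HasFiniteSupport T)
    (x : UnitAddTorus (Fin d)) : latF (fun y => c * T y) x = (c : ℂ) * latF T x := by
  have hcT : Function.support (fun y => c * T y) ⊆ (hT.toFinset : Finset (Fin d → ℤ)) :=
    (Function.support_mul_subset_right _ _).trans (support_subset_toFinset hT)
  rw [latF_eq_latFT hcT, latF_eq_latFT (support_subset_toFinset hT), latFT_apply, latFT_apply,
    Finset.mul_sum]
  refine Finset.sum_congr rfl fun y _ => ?_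
  push_cast
  ring

/-- `latF` of a finite sum of finitely supported families. [folklore] -/
theorem latF_finset_sum {ι : Type*} (I : Finset ι) {T : ι → (Fin d → ℤ) → ℝ}
    (hT : ∀ i ∈ I, HasFiniteSupport (T i)) (x : UnitAddTorus (Fin d)) :
    latF (fun y => ∑ i ∈ I, T i y) x = ∑ i ∈ I, latF (T i) x := by
  classical
  -- a common ambient set
  set S : Finset (Fin d → ℤ) := I.attach.biUnion fun i => (hT i.1 i.2).toFinset with hS
  have hiS : ∀ i (hi : i ∈ I), Function.support (T i) ⊆ S := by
    intro i hi y hy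
    simp only [hS, Finset.coe_biUnion, Finset.mem_coe, Finset.mem_attach, Set.iUnion_true,
      Set.mem_iUnion, Set.Finite.coe_toFinset, Subtype.exists]
    exact ⟨i, hi, hy⟩
  have hsumS : Function.support (fun y => ∑ i ∈ I, T i y) ⊆ S := by
    intro y hy
    simp only [Function.mem_support, ne_eq] at hy
    by_contra hyS
    apply hy
    exact Finset.sum_eq_zero fun i hi => by
      by_contra hne
      exact hyS (hiS i hi (Function.mem_support.2 hne))
  rw [latF_eq_latFT hsumS, latFT_apply]
  have hterm : ∀ i ∈ I, latF (T i) x = latFT S (T i) x := fun i hi =>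
    congrFun (latF_eq_latFT (hiS i hi)) x
  rw [Finset.sum_congr rfl hterm]
  simp only [latFT_apply, Complex.ofReal_sum, Finset.mul_sum]
  rw [Finset.sum_comm]

/-! ### Translations -/

/-- **`(T(·+a))^ = e_{-a} · T̂`**. [folklore] -/
theorem latF_comp_add {T : (Fin d → ℤ) → ℝ} (hT : HasFiniteSupport T) (a : Fin d → ℤ)
    (x : UnitAddTorus (Fin d)) :
    latF (fun y => T (y + a)) x = UnitAddTorus.mFourier (-a) x * latF T x := by
  classical
  have h1 := latFT_comp_add hT.toFinset T a x
  rw [latF_eq_latFT (support_comp_add_subset (support_subset_toFinset hT) a),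
    latF_eq_latFT (support_subset_toFinset hT), h1]

/-- **`(T(·-a))^ = e_{a} · T̂`**. [folklore] -/
theorem latF_comp_sub {T : (Fin d → ℤ) → ℝ} (hT : HasFiniteSupport T) (a : Fin d → ℤ)
    (x : UnitAddTorus (Fin d)) :
    latF (fun y => T (y - a)) x = UnitAddTorus.mFourier a x * latF T x := by
  have h := latF_comp_add hT (-a) x
  simp only [neg_neg, ← sub_eq_add_neg] at h
  exact h

/-! ### The second difference operator and the dispersion multiplier -/

/-- The scalar lattice Laplacian `(-ΔT)(y) = ∑ᵢ ((T y - T (y+eᵢ)) + (T y - T (y-eᵢ)))`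
(same formula as `LatticeChain.negLap₀`). [folklore] -/
def secondDiff (T : (Fin d → ℤ) → ℝ) : (Fin d → ℤ) → ℝ :=
  fun y => ∑ i, ((T y - T (y + e i)) + (T y - T (y - e i)))

/-- For unimodular `z`, `2 - conj z - z = ‖z - 1‖²`. [folklore] -/
theorem two_sub_conj_sub_self {z : ℂ} (hz : ‖z‖ = 1) :
    (2 : ℂ) - conj z - z = ((‖z - 1‖ ^ 2 : ℝ) : ℂ) := by
  have h1 : ((‖z - 1‖ ^ 2 : ℝ) : ℂ) = (z - 1) * conj (z - 1) := by
    rw [Complex.mul_conj, Complex.normSq_eq_norm_sq]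
  have h2 : z * conj z = 1 := by
    rw [Complex.mul_conj, Complex.normSq_eq_norm_sq, hz]
    simp
  rw [h1, map_sub, map_one]
  linear_combination -h2

/-- The character `e_{eᵢ}(x) = 𝐞(xᵢ)` is unimodular. [folklore] -/
theorem norm_mFourier_apply (n : Fin d → ℤ) (x : UnitAddTorus (Fin d)) :
    ‖UnitAddTorus.mFourier n x‖ = 1 := by
  simp only [UnitAddTorus.mFourier, ContinuousMap.coe_mk, norm_prod]
  exact Finset.prod_eq_one fun i _ => by simp

/-- **`(-ΔT)^ = μ · T̂`** with `μ = latticeDispersion`. [folklore] -/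
theorem latF_secondDiff {T : (Fin d → ℤ) → ℝ} (hT : HasFiniteSupport T) (x : UnitAddTorus (Fin d)) :
    latF (secondDiff T) x = ((latticeDispersion x : ℝ) : ℂ) * latF T x := by
  classical
  -- finite supports of the shifted families
  have hTa : ∀ i : Fin d, HasFiniteSupport fun y => T (y + e i) := fun i => by
    have : Function.support (fun y => T (y + e i)) = (fun y => y + e i) ⁻¹' Function.support T := by
      ext y; simp
    rw [HasFiniteSupport, this]
    exact hT.preimage fun y _ y' _ h => add_right_cancel h
  have hTs : ∀ i : Fin d, HasFiniteSupport fun y => T (y - e i) := fun i => by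
    have : Function.support (fun y => T (y - e i)) = (fun y => y - e i) ⁻¹' Function.support T := by
      ext y; simp
    rw [HasFiniteSupport, this]
    exact hT.preimage fun y _ y' _ h => sub_left_injective h
  have hterm : ∀ i : Fin d, HasFiniteSupport fun y => (T y - T (y + e i)) + (T y - T (y - e i)) :=
    fun i => (hT.sub (hTa i)).add (hT.sub (hTs i))
  -- expand
  have hsum := latF_finset_sum (Finset.univ : Finset (Fin d)) (fun i _ => hterm i) x
  have hsd : secondDiff T = fun y => ∑ i, ((T y - T (y + e i)) + (T y - T (y - e i))) := rfl
  rw [hsd, hsum]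
  have hi : ∀ i : Fin d, latF (fun y => (T y - T (y + e i)) + (T y - T (y - e i))) x =
      ((‖(fourier 1 (x i) : ℂ) - 1‖ ^ 2 : ℝ) : ℂ) * latF T x := by
    intro i
    have h1 : (fun y => (T y - T (y + e i)) + (T y - T (y - e i))) =
        (T - fun y => T (y + e i)) + (T - fun y => T (y - e i)) := by
      funext y; simp
    rw [h1, latF_add (hT.sub (hTa i)) (hT.sub (hTs i)), latF_sub hT (hTa i), latF_sub hT (hTs i)]
    simp only [Pi.add_apply, Pi.sub_apply]
    rw [latF_comp_add hT, latF_comp_sub hT, UnitAddTorus.mFourier_neg, UnitAddTorus.mFourier_single,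
      ← two_sub_conj_sub_self (by rw [fourier_apply, Circle.norm_coe])]
    ring
  simp only [hi, ← Finset.sum_mul]
  congr 1
  rw [latticeDispersion]
  push_cast
  rfl

end LatticeFourier

end Literature.Analysis.FunctionSpaces
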